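import Mathlib.AlgebraicGeometry.Morphisms.Separated
import Literature.AlgebraicGeometry.Motives.AlgPointsNonempty
import HarnessLib

/-!
# Coincidence and fixed points over two algebraically closed fields: `∃ P ∈ X(L), f P = g P` does not depend on `L`
# ([GortzWedhorn2020] Prop. 3.35 ∕ Cor. 3.36 (Nullstellensatz) with Def.∕Prop. 9.7 (the kernel `Eq(f, g)` is a subscheme); [Hartshorne1977] II Ex. 4.8 context)

Topic `Literature/AlgebraicGeometry/Motives`, namespace `Literature.AlgebraicGeometry.Motives.AlgPoints`.  Theorems only; NO definition, no named
fact, no instance, no notation, no `sorry`.  Cell `hodgecm-mathlib` (D-0151), FLOOR 0, programme F0P5a (D9op road 2′, crux item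
stmt-HodgeConjecture-24832), the generic «TRANSPORT `ℂ → Ω`» half (R2) of row (b12) «NEAT-FREE» of F0P5a-plan (g3)՚s ED. 5.1 letter patch
(`RecordNeatLevelFullFibres`): freeness of the level action on the record curve is known on `ℂ`-points (complex uniformisation, ★
`UnitaryBallUniformisationDatum.eq_one_of_act_eq_smul`) and is needed on `Ω = \overline{F_w}`-points.  No embedding `Ω → ℂ` is chosen (no
cardinality road, no compatibility with `ι₁`): the coincidence locus of two `k`-morphisms `f, g : X ⟶ Y` IS A `k`-SCHEME — Mathlib՚s equalizer
`Limits.equalizer f g` in `Over (Spec k)`, a closed subscheme of `X` when `Y` is separated (Mathlib `isClosedImmersion_equalizer_ι_left`,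
[GortzWedhorn2020] Def.∕Prop. 9.7) — so Hilbert՚s Nullstellensatz in the point form ★ `AlgPoints.nonempty_iff` («`Z(L) ≠ ∅ ↔ Z ≠ ∅` for `Z`
locally of finite type and `L` algebraically closed») moves the existence of a coincidence point between ANY two algebraically closed
`k`-fields `L`, `L′`:

* `exists_map_eq_map_iff_nonempty_algPoints_equalizer` — `(∃ P ∈ X(L), f P = g P) ↔ (Eq(f,g))(L) ≠ ∅` (universal property, any field `L`);
* `locallyOfFiniteType_equalizer_hom` — `Eq(f, g)` is locally of finite type over `k` when `X` is and `Y` is separated;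
* `exists_map_eq_map_iff_nonempty_equalizer` — `… ↔ Eq(f, g) ≠ ∅` for `L` algebraically closed (Nullstellensatz);
* **`exists_map_eq_map_iff`** — `(∃ P ∈ X(L), f P = g P) ↔ (∃ P ∈ X(L′), f P = g P)`;
* fixed points of an endomorphism `φ : X ⟶ X` (`g := 𝟙`): **`exists_map_eq_self_iff`**, and the two transfer forms used by (b12):
  **`forall_map_ne_self_of_forall`** (`φ` has no fixed `L′`-point ⇒ no fixed `L`-point) and **`forall_map_eq_self_imp_of_forall`**
  (`(∀ P ∈ X(L′), φ P = P → c) → ∀ P ∈ X(L), φ P = P → c` for any proposition `c`, e.g. «`k ∈ N′`»).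

At (b12): `k := F`, `X := S.M.obj N′` (projective, hence separated and of finite type), `φ := T_k` (a record automorphism), `L′ := ℂ` over
`ι₁`, `L := AlgebraicClosure (w.adicCompletion F)`.  Decision-independent, record-free.  HC_CM is proved only modulo the 7 printed
citations until rung 0 closes; this file is a generic leaf and changes no count.

## References
* [GortzWedhorn2020] U. Görtz, T. Wedhorn, *Algebraic Geometry I: Schemes*, 2nd ed. (2020): Prop. 3.35, Cor. 3.36 (closed points of schemes
  locally of finite type over a field; rational over an algebraically closed field), Def.∕Prop. 9.7 (the kernel of two morphisms `Eq(f, g)`,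
  a (closed, for separated target) subscheme), §(5.2) (`X(L)`).
* [Hartshorne1977] R. Hartshorne, *Algebraic Geometry*, II Ex. 2.7 (`L`-points), II §4 (separatedness; the locus where two morphisms agree
  is closed, Ex. 4.8).
-/

set_option autoImplicit false

universe u

open CategoryTheory CategoryTheory.Limits AlgebraicGeometry

noncomputable section

namespace Literature.AlgebraicGeometry.Motives

namespace AlgPoints

variable {k : Type u} [Field k] {X Y : SchemeOver k}

section Coincidence

variable (f g : X ⟶ Y) (L : Type u) [Field L] [Algebra k L]

/-! ### §1 Points of the coincidence scheme `Eq(f, g)` -/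

/-- **`(∃ P ∈ X(L), f P = g P) ↔ Eq(f, g)(L) ≠ ∅`**: an `L`-point of `X` at which `f` and `g` agree is the same as an `L`-point of the
equalizer `Eq(f, g) = Limits.equalizer f g` (computed in `k`-schemes) — universal property (`equalizer.lift` ∕ `equalizer.ι`, `equalizer.condition`).
Any field `L`. [cite: GortzWedhorn2020, Def./Prop. 9.7] -/
theorem exists_map_eq_map_iff_nonempty_algPoints_equalizer :
    (∃ P : AlgPoints X L, map f P = map g P) ↔ Nonempty (AlgPoints (equalizer f g) L) := by
  constructor
  · rintro ⟨P, hP⟩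
    exact ⟨equalizer.lift P hP⟩
  · rintro ⟨Q⟩
    refine ⟨map (equalizer.ι f g) Q, ?_⟩
    rw [map_apply, map_apply, map_apply, Category.assoc, Category.assoc, equalizer.condition]

/-- The `L`-points of `X` at which `f` and `g` agree are exactly the images of the `L`-points of `Eq(f, g)` under `equalizer.ι`.
[cite: GortzWedhorn2020, Def./Prop. 9.7] -/
theorem setOf_map_eq_map_eq_range_map_equalizerι :
    {P : AlgPoints X L | map f P = map g P} = Set.range (map (L := L) (equalizer.ι f g)) := by
  ext P
  simp only [Set.mem_setOf_eq, Set.mem_range]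
  constructor
  · intro hP
    exact ⟨equalizer.lift P hP, by rw [map_apply, equalizer.lift_ι]⟩
  · rintro ⟨Q, rfl⟩
    rw [map_apply, map_apply, map_apply, Category.assoc, Category.assoc, equalizer.condition]

/-- **`Eq(f, g)` is locally of finite type over `k`** when `X` is and `Y → Spec k` is separated: its structure map is the closed immersion
`Eq(f, g) ↪ X` (Mathlib `isClosedImmersion_equalizer_ι_left`) followed by `X → Spec k`. [cite: GortzWedhorn2020, Def./Prop. 9.7] -/
theorem locallyOfFiniteType_equalizer_hom [LocallyOfFiniteType X.hom] [IsSeparated Y.hom] :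
    LocallyOfFiniteType (equalizer f g).hom := by
  rw [← Over.w (equalizer.ι f g)]
  infer_instance

/-! ### §2 Nullstellensatz: existence of a coincidence point does not depend on the algebraically closed field -/

/-- **`(∃ P ∈ X(L), f P = g P) ↔ Eq(f, g) ≠ ∅`** for `L ⊇ k` algebraically closed, `X` locally of finite type, `Y` separated over `k` (Hilbert՚s
Nullstellensatz in the point form ★ `AlgPoints.nonempty_iff` applied to the scheme `Eq(f, g)`).
[cite: GortzWedhorn2020, Prop. 3.35, Cor. 3.36 and Def./Prop. 9.7] -/
theorem exists_map_eq_map_iff_nonempty_equalizer [LocallyOfFiniteType X.hom] [IsSeparated Y.hom] [IsAlgClosed L] :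
    (∃ P : AlgPoints X L, map f P = map g P) ↔ Nonempty (equalizer f g).left := by
  haveI := locallyOfFiniteType_equalizer_hom f g
  rw [exists_map_eq_map_iff_nonempty_algPoints_equalizer, AlgPoints.nonempty_iff]

/-- **Transfer of coincidence points between algebraically closed fields**: for `X` locally of finite type and `Y` separated over `k`, and
two INDEPENDENT algebraically closed `k`-fields `L, L′` (any `[Algebra k L]`, `[Algebra k L′]`; same universe as `k`), `f` and `g` agree at some
`L`-point iff they agree at some `L′`-point (both say `Eq(f, g) ≠ ∅`). [cite: GortzWedhorn2020, Prop. 3.35, Cor. 3.36 and Def./Prop. 9.7] -/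
theorem exists_map_eq_map_iff [LocallyOfFiniteType X.hom] [IsSeparated Y.hom] [IsAlgClosed L]
    (L' : Type u) [Field L'] [Algebra k L'] [IsAlgClosed L'] :
    (∃ P : AlgPoints X L, map f P = map g P) ↔ (∃ P : AlgPoints X L', map f P = map g P) := by
  rw [exists_map_eq_map_iff_nonempty_equalizer f g L, exists_map_eq_map_iff_nonempty_equalizer f g L']

/-- If every `L′`-coincidence point of `f, g` forces a proposition `c`, so does every `L`-coincidence point.
[cite: GortzWedhorn2020, Prop. 3.35, Cor. 3.36 and Def./Prop. 9.7] -/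
theorem forall_map_eq_map_imp_of_forall [LocallyOfFiniteType X.hom] [IsSeparated Y.hom] [IsAlgClosed L]
    (L' : Type u) [Field L'] [Algebra k L'] [IsAlgClosed L'] {c : Prop} (h : ∀ P : AlgPoints X L', map f P = map g P → c) :
    ∀ P : AlgPoints X L, map f P = map g P → c := by
  intro P hP
  obtain ⟨Q, hQ⟩ := (exists_map_eq_map_iff f g L L').1 ⟨P, hP⟩
  exact h Q hQ

end Coincidence

/-! ### §3 Fixed points of an endomorphism -/

section Fixed

variable (φ : X ⟶ X) (L L' : Type u) [Field L] [Algebra k L] [IsAlgClosed L] [Field L'] [Algebra k L'] [IsAlgClosed L']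

/-- **Fixed points transfer**: an endomorphism `φ` of a separated `k`-scheme locally of finite type has a fixed `L`-point iff it has a fixed
`L′`-point (`L, L′` two independent algebraically closed `k`-fields) — `exists_map_eq_map_iff` at `(f, g) := (φ, 𝟙)`.
[cite: GortzWedhorn2020, Prop. 3.35, Cor. 3.36 and Def./Prop. 9.7] -/
theorem exists_map_eq_self_iff [LocallyOfFiniteType X.hom] [IsSeparated X.hom] :
    (∃ P : AlgPoints X L, map φ P = P) ↔ (∃ P : AlgPoints X L', map φ P = P) := by
  have h := exists_map_eq_map_iff φ (𝟙 X) L L'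
  simpa only [map_id_apply] using h

/-- **Freeness transfer** (the shape consumed by (b12)): if `φ` has no fixed `L′`-point then it has no fixed `L`-point (`L, L′ ⊇ k` two
independent algebraically closed `k`-fields — e.g. `L′ := ℂ` under `letI := ι₁.toAlgebra`, `L := AlgebraicClosure (w.adicCompletion F)`;
`X` separated and locally of finite type over `k`, e.g. projective). [cite: GortzWedhorn2020, Prop. 3.35, Cor. 3.36 and Def./Prop. 9.7] -/
theorem forall_map_ne_self_of_forall [LocallyOfFiniteType X.hom] [IsSeparated X.hom] (h : ∀ P : AlgPoints X L', map φ P ≠ P) :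
    ∀ P : AlgPoints X L, map φ P ≠ P := by
  intro P hP
  obtain ⟨Q, hQ⟩ := (exists_map_eq_self_iff φ L L').1 ⟨P, hP⟩
  exact h Q hQ

/-- **Stabiliser transfer**: for any proposition `c` (e.g. «the group element lies in the sublevel `N′`»), if every fixed `L′`-point of `φ`
forces `c`, then so does every fixed `L`-point. [cite: GortzWedhorn2020, Prop. 3.35, Cor. 3.36 and Def./Prop. 9.7] -/
theorem forall_map_eq_self_imp_of_forall [LocallyOfFiniteType X.hom] [IsSeparated X.hom] {c : Prop}
    (h : ∀ P : AlgPoints X L', map φ P = P → c) : ∀ P : AlgPoints X L, map φ P = P → c := by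
  intro P hP
  obtain ⟨Q, hQ⟩ := (exists_map_eq_self_iff φ L L').1 ⟨P, hP⟩
  exact h Q hQ

end Fixed

end AlgPoints

end Literature.AlgebraicGeometry.Motives

end
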